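/- Width seat `ym-line-sfw-p2-w5` (prover-ym-line-sfw-p2-w5-g18-0), free hands on planner ym-idea-2 g16's LINE-19 entry kit
(crux `AllWindowsColdBox.BoxHighWindowsSU22` = stmt-QuantumFields-24004 / low item 24335, stub S4b Stage II bookkeeping H4b.1″):
the cubic shell sum of the planner's checked scratch `l26/S4bHelpers-scratch-v3.lean` (sha16 58dae9438411fbe2), as a pure-proof module. -/
import Summits.QuantumFields.YangMills.Theorems.AllWindowsColdBoxBoxHighWindowsSU22LineDefs
import Summits.QuantumFields.YangMills.Theorems.AllWindowsColdBoxDirResponseL1OfDipoleDecay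

/-!
# LINE-19 S4b, H4b.1″: the cubic lattice shell sum `Σ_{‖w‖_∞ ≤ R} (1 + ‖w‖₁)⁻³ ≤ 1 + 80·R` and the plaquette shell sum `≤ 5136·H`

Stage II of the S4b plan (`Cruxes/BoxHighWindowsSU22/STUB-PLAN-S4b.md` §7–§8) turns the kernel-GRADIENT decay H4b.1′
(`|(hodgeQ⁻¹ landauCoeff p)_e| ≤ C(1+log H)/(1+‖e−p‖₁)³`) into the row-sum bound H4b.1 (`Σ_p |…| ≤ C·H·(1+log H)`, ONE log) through a
kernel-free counting lemma, H4b.1″.  This file proves H4b.1″ with explicit constants, adapting the tree's exponent-4 LINE-18 K2 lemmas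
(`AllWindowsColdBoxLatticeShellSum`, `DirResponse.sum_inv_pow_four_enlargedBox_le`) to exponent 3 and reusing
`ShellSum.mem_cube / card_cube / cube_subset_succ / succ_le_l1_of_mem_sdiff` and `DirResponse.plaquettesIn_subset_product` BY NAME:

* `sum_cube_inv_pow_three_le`: `Σ_{w ∈ {−R..R}⁴} (1 + Σ_m |w_m|)⁻³ ≤ 1 + 80·R` (shell `‖w‖_∞ = r+1` has `≤ 80(r+2)³` points on which
  `1 + ‖w‖₁ ≥ r+2` — so the cubic sum carries NO logarithm, whence H4b.1 has exactly one log and S4b's typed `(1+log H)²` stands);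
* `sum_inv_pow_three_enlargedBox_le`: for `x ∈ {−1,…,2H+1}⁴`, `Σ_{q ∈ shift(dirCorner) plaquettesIn {0..2H+2}⁴} (1 + ‖x − q.1‖₁)⁻³ ≤ 16·(1 + 80·(2H+2))`;
* `plaquetteShellSum`: for a Landau free edge `e` of the cold box (`LandauFree H`, line defs ✓), the same sum from its base site is `≤ 5136·H`.

Lean text: planner ym-idea-2 g16 (checked scratch, rc 0); this seat made it a module (explicit statement instead of the scratch's Prop
`PlaquetteShellSum`, tree lemma instead of a restated `plaquettesIn_subset_product`) and re-checked.  Everything proved; no definition;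
standard axioms.  HONEST LABEL: a counting helper toward ONE registered stub (S4b) of a critic-PASSed line on the R2ξ″ RECORD-rung crux
24004 / 24335; no stub is proved by name, no crux, rung or summit is proved; the Yang–Mills mass gap is NOT proved by this file.
-/

set_option autoImplicit false

noncomputable section

open Finset
open Literature.MathematicalPhysics.QuantumFieldTheory
open Literature.MathematicalPhysics.QuantumFieldTheory.LatticeMaxwell
open Literature.MathematicalPhysics.QuantumFieldTheory.AxialGauge
open Summit.QuantumFields.YangMills.Theorems.WeakCouplingRates
open Summit.QuantumFields.YangMills.Theorems.AllWindowsColdBox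

namespace Summit.QuantumFields.YangMills.Theorems.AllWindowsColdBoxBoxHighLine

section ShellSumCubic

open Summit.QuantumFields.YangMills.Theorems.AllWindowsColdBox.ShellSum
open Literature.Probability.LatticeModels (Site mem_halfOpenBox halfOpenBox)

/-- **Shell-by-shell bound, exponent 3**: `Σ_{cube R} (1 + ‖w‖₁)⁻³ ≤ 1 + 80·R` (each shell `‖w‖_∞ = r+1` has `≤ 80(r+2)³` points,
on which `1+‖w‖₁ ≥ r+2`). -/
theorem sum_cube_inv_pow_three_le (R : ℕ) :
    ∑ w ∈ Fintype.piFinset (fun _ : Fin 4 => Finset.Icc (-(R : ℤ)) R), 1 / (1 + ∑ m : Fin 4, (|w m| : ℝ)) ^ 3 ≤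
      1 + 80 * (R : ℝ) := by
  induction R with
  | zero =>
    have hcube : Fintype.piFinset (fun _ : Fin 4 => Finset.Icc (-((0 : ℕ) : ℤ)) (0 : ℕ)) = {0} := by
      ext w
      rw [mem_cube, Finset.mem_singleton]
      constructor
      · intro h; funext m; have := h m; simp at this; exact this
      · rintro rfl m; simp
    rw [hcube]; simp
  | succ R ih =>
    have hsub := cube_subset_succ R
    rw [← Finset.sum_sdiff hsub]
    have hshell : ∑ w ∈ Fintype.piFinset (fun _ : Fin 4 => Finset.Icc (-((R + 1 : ℕ) : ℤ)) (R + 1 : ℕ)) \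
        Fintype.piFinset (fun _ : Fin 4 => Finset.Icc (-(R : ℤ)) R), 1 / (1 + ∑ m : Fin 4, (|w m| : ℝ)) ^ 3 ≤ 80 := by
      have hterm : ∀ w ∈ Fintype.piFinset (fun _ : Fin 4 => Finset.Icc (-((R + 1 : ℕ) : ℤ)) (R + 1 : ℕ)) \
          Fintype.piFinset (fun _ : Fin 4 => Finset.Icc (-(R : ℤ)) R),
          1 / (1 + ∑ m : Fin 4, (|w m| : ℝ)) ^ 3 ≤ 1 / ((R : ℝ) + 2) ^ 3 := by
        intro w hw
        have h1 := succ_le_l1_of_mem_sdiff hw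
        have hpos : (0 : ℝ) < ((R : ℝ) + 2) ^ 3 := by positivity
        exact one_div_le_one_div_of_le hpos (pow_le_pow_left₀ (by positivity) (by linarith) 3)
      refine (Finset.sum_le_sum hterm).trans ?_
      rw [Finset.sum_const, nsmul_eq_mul, Finset.card_sdiff_of_subset hsub, card_cube, card_cube]
      have hc : (((2 * (R + 1) + 1) ^ 4 - (2 * R + 1) ^ 4 : ℕ) : ℝ) = (2 * (R : ℝ) + 3) ^ 4 - (2 * R + 1) ^ 4 := by
        have hle : (2 * R + 1) ^ 4 ≤ (2 * (R + 1) + 1) ^ 4 := Nat.pow_le_pow_left (by omega) 4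
        rw [Nat.cast_sub hle]; push_cast; ring
      rw [hc]
      have hR : (0 : ℝ) ≤ R := Nat.cast_nonneg R
      have hpoly : (2 * (R : ℝ) + 3) ^ 4 - (2 * R + 1) ^ 4 ≤ 80 * ((R : ℝ) + 2) ^ 3 := by nlinarith
      have hpos : (0 : ℝ) < (R : ℝ) + 2 := by positivity
      calc ((2 * (R : ℝ) + 3) ^ 4 - (2 * R + 1) ^ 4) * (1 / ((R : ℝ) + 2) ^ 3)
          ≤ 80 * ((R : ℝ) + 2) ^ 3 * (1 / ((R : ℝ) + 2) ^ 3) :=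
            mul_le_mul_of_nonneg_right hpoly (by positivity)
        _ = 80 := by field_simp
    calc _ ≤ 80 + (1 + 80 * (R : ℝ)) := add_le_add hshell ih
      _ = 1 + 80 * ((R + 1 : ℕ) : ℝ) := by push_cast; ring

/-- **The kernel-free cubic lattice sum over the enlarged box**: for `x ∈ {−1,…,2H+1}⁴`,
`Σ_{q ∈ shift(dirCorner) plaquettesIn {0..2H+2}⁴} (1 + Σ_m |x_m − q.1_m|)⁻³ ≤ 16·(1 + 80·(2H+2))`. -/
theorem sum_inv_pow_three_enlargedBox_le {H : ℕ} (x : Site 4) (hx : ∀ m, -1 ≤ x m ∧ x m ≤ 2 * (H : ℤ) + 1) :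
    ∑ q ∈ (plaquettesIn (halfOpenBox 4 (2 * H + 3))).image (Plaq.shift dirCorner),
        1 / (1 + (((∑ m : Fin 4, |x m - q.1 m|) : ℤ) : ℝ)) ^ 3 ≤
      16 * (1 + 80 * (((2 * H + 2 : ℕ)) : ℝ)) := by
  classical
  set f : (Fin 4 → ℤ) → ℝ := fun w => 1 / (1 + ∑ m : Fin 4, (|w m| : ℝ)) ^ 3 with hf
  have hf0 : ∀ w, 0 ≤ f w := fun w => by simp only [hf]; positivity
  set φ : Site 4 → (Fin 4 → ℤ) := fun y => y + dirCorner - x with hφ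
  have hterm : ∀ p : Plaq 4, 1 / (1 + (((∑ m : Fin 4, |x m - (Plaq.shift dirCorner p).1 m|) : ℤ) : ℝ)) ^ 3 = f (φ p.1) := by
    intro p
    simp only [hf, hφ, Plaq.shift_fst, Int.cast_sum, Int.cast_abs, Int.cast_sub, Pi.add_apply, Pi.sub_apply]
    congr 2; congr 1
    refine Finset.sum_congr rfl fun m _ => ?_
    rw [← abs_neg]; congr 1; push_cast; ring
  rw [Finset.sum_image fun p _ q _ h => Plaq.shift_injective _ h]
  simp_rw [hterm]
  have h1 : ∑ p ∈ plaquettesIn (halfOpenBox 4 (2 * H + 3)), f (φ p.1) ≤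
      ∑ p ∈ halfOpenBox 4 (2 * H + 3) ×ˢ ((Finset.univ : Finset (Fin 4)) ×ˢ (Finset.univ : Finset (Fin 4))), f (φ p.1) :=
    Finset.sum_le_sum_of_subset_of_nonneg (DirResponse.plaquettesIn_subset_product _) fun _ _ _ => hf0 _
  refine h1.trans ?_
  rw [Finset.sum_product]
  have hconst : ∀ y : Site 4,
      ∑ _z ∈ (Finset.univ : Finset (Fin 4)) ×ˢ (Finset.univ : Finset (Fin 4)), f (φ y) = 16 * f (φ y) := fun y => by
    rw [Finset.sum_const, Finset.card_product, Finset.card_univ, Fintype.card_fin, nsmul_eq_mul]; norm_num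
  simp_rw [hconst]
  rw [← Finset.mul_sum]
  refine mul_le_mul_of_nonneg_left ?_ (by norm_num)
  have hφinj : Set.InjOn φ (halfOpenBox 4 (2 * H + 3) : Set (Site 4)) := by
    intro a _ b _ hab
    simp only [hφ] at hab
    have := congr_arg (fun w => w - dirCorner + x) hab
    simpa using this
  rw [← Finset.sum_image hφinj]
  refine (Finset.sum_le_sum_of_subset_of_nonneg ?_ fun _ _ _ => hf0 _).trans (sum_cube_inv_pow_three_le (2 * H + 2))
  intro w hw
  obtain ⟨y, hy, rfl⟩ := Finset.mem_image.1 hw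
  rw [mem_cube]
  intro m
  have hym := (mem_halfOpenBox.1 (Finset.mem_coe.1 hy)) m
  have hxm := hx m
  simp only [hφ, Pi.add_apply, Pi.sub_apply, dirCorner]
  rw [abs_le]; push_cast; constructor <;> omega

/-- **H4b.1″ (the plan's Prop `PlaquetteShellSum`, with the explicit constant `C = 5136 = 16·321`)**: for `H ≥ 1` and every Landau free edge `e`
of the cold box, `Σ_{p ∈ shift(dirCorner) plaquettesIn {0..2H+2}⁴} (1 + ‖base e − base p‖₁)⁻³ ≤ 5136·H` (the base site of a free edge lies in
`{−1,…,2H+1}⁴`, then `sum_inv_pow_three_enlargedBox_le`). -/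
theorem plaquetteShellSum {H : ℕ} (hH : 1 ≤ H) (e : LandauFree H) :
    ∑ p ∈ (plaquettesIn (halfOpenBox 4 (2 * H + 3))).image (Plaq.shift dirCorner),
      1 / (1 + (((∑ m : Fin 4, |e.1.1.1 m - p.1 m|) : ℤ) : ℝ)) ^ 3 ≤ 5136 * (H : ℝ) := by
  have hx : ∀ m, -1 ≤ e.1.1.1 m ∧ e.1.1.1 m ≤ 2 * (H : ℤ) + 1 := fun m => by
    have hmem := LatticeMaxwell.mem_boxEdgesAt.1 e.1.2
    rcases e' : e.1.1 with ⟨y, i⟩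
    rw [e'] at hmem
    have hk := ((mem_boxEdges_iff.1 hmem).1) m
    simp only [Pi.sub_apply, dirCorner] at hk
    show -1 ≤ y m ∧ y m ≤ 2 * (H : ℤ) + 1
    push_cast at hk
    constructor <;> omega
  have h := sum_inv_pow_three_enlargedBox_le (H := H) e.1.1.1 hx
  have hH' : (1 : ℝ) ≤ H := by exact_mod_cast hH
  have hb : 16 * (1 + 80 * (((2 * H + 2 : ℕ)) : ℝ)) ≤ 5136 * (H : ℝ) := by push_cast; nlinarith
  exact h.trans hb

end ShellSumCubic

end Summit.QuantumFields.YangMills.Theorems.AllWindowsColdBoxBoxHighLine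

end
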